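import Literature.Probability.LatticeModels.KCLayerBound
import Literature.Probability.LatticeModels.KCLayerBoundKC
import Literature.Probability.LatticeModels.KCSectionFamilyBoundary
import HarnessLib

/-!
# Lemma 3.10 on the lattice for the two-point family: the layers near `a` and near `b`

Topic `Literature/Probability/LatticeModels`. The abstract layer bounds `layer_bound_sink` /
`layer_bound_source` (`KCLayerBound.lean`, Chelkak–Hongler–Izyurov 2015, Lemma 3.10 on the lattice)
instantiated for the Kadanoff–Ceva primitive `(Hw, Hb)` of the two-point family
`twoPointFamily Ω a b` (`KCTwoPointFamily.lean`: `+` boundary values on the component volume of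
`Ω_δ`, one background spin at `b̂ = nearestSite δ b`, source plaquette `p₀ = sourcePlaq δ a`):

* `eventually_ball_subset_compVol`: for a closed disc in `Ω`, eventually every site with mesh point
  in the disc is a site of the component volume;
* **`twoPointFamily_layer_sink`** (near `b`) and **`twoPointFamily_layer_source`** (near `a`):
  there is `r > 0` such that, for all small `δ` and all lattice radii `3 ≤ R₁`, `t`, `R₂` with
  `(R₂ + 2)δ ≤ r` and the Beurling smallness of `(t + O(1))/R₁`, if `|Hw - c₀|, |Hb - c₀| ≤ m` on the
  annulus `sqBox ĉ R₂ ∖ sqBox ĉ (R₁ + t)` then on the layer `sqBox ĉ R₁ ∖ sqBox ĉ (R₁ - 1)` the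
  shifted primitive is within `[-132 m, m]` (near `b`) / `[-m, 132 m]` (near `a`).

The local hypotheses (super/sub-harmonicity, `Hw ≤ Hb`, comparability with even sign parities) are
supplied by `IsingDisorderLaplacian.lean` and `KCLayerBoundKC.lean`. Everything is proved; no named
fact.

## References

* D. Chelkak, C. Hongler, K. Izyurov, Ann. of Math. 181 (2015), Lemma 3.10 and §3.5
  [ChelkakHonglerIzyurovAnnals2015].
* D. Chelkak, S. Smirnov, Invent. Math. 189 (2012), Remark 3.10 [ChelkakSmirnov2012Ising].
-/

noncomputable section

namespace Literature.Probability.LatticeModels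

open Complex Filter Metric Set _root_.Topology Finset SimpleGraph WeakBeurling

variable {Ω : Set ℂ} {a : ℂ}

/-- `Δ (H - c₀) = Δ H`. [folklore] -/
theorem latticeLaplacian_sub_const (H : Site 2 → ℝ) (c : ℝ) (v : Site 2) :
    latticeLaplacian (fun x => H x - c) v = latticeLaplacian H v := by
  simp [latticeLaplacian]

/-- **Eventually every site with mesh point in a closed disc of `Ω` is a site of the component
volume.** [cite: ChelkakHonglerIzyurovAnnals2015, §3.3] -/
theorem eventually_ball_subset_compVol (hΩo : IsOpen Ω) (hΩc : IsConnected Ω) (hM : MeshApproximates Ω) (ha : a ∈ Ω)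
    {c : ℂ} {ρ : ℝ} (hρ : closedBall c ρ ⊆ Ω) :
    ∀ᶠ δ in 𝓝[>] (0 : ℝ), ∀ y : Site 2, dist (meshPoint δ y) c ≤ ρ → y ∈ compVol Ω a δ := by
  obtain ⟨ρ₀, hρ₀, h⟩ := eventually_bulk_mem_compOf hΩo hΩc hM ha (isCompact_closedBall c ρ) hρ
  filter_upwards [h] with δ h y hy
  exact mem_compVol.2 (h y y (mem_closedBall.2 hy) (by rw [_root_.dist_self]; exact hρ₀.le)).2

/-- Sites of a lattice box around a site near `c` have mesh points near `c`. [folklore] -/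
theorem dist_meshPoint_le_of_mem_sqBox_near {δ : ℝ} (hδ : 0 < δ) {q y : Site 2} {c : ℂ} {d : ℝ}
    (hq : dist (meshPoint δ q) c ≤ d) {n : ℤ} (hy : y ∈ sqBox q n) :
    dist (meshPoint δ y) c ≤ 2 * δ * n + d :=
  (dist_triangle _ (meshPoint δ q) _).trans (add_le_add (dist_meshPoint_le_two_mul_of_mem_sqBox hδ.le hy) hq)

section Common

variable {b : ℂ} {δ : ℝ}

/-- The sides of a plaquette whose corners are in the component volume touch the volume. [folklore] -/
theorem sides_mem_edgesTouching {f : Site 2} (h : ∀ j : Fin 4, f + cornerOff j ∈ compVol Ω a δ) (j : Fin 4) :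
    s(f + cornerOff j, f + cornerOff j + cornerUnit j) ∈ edgesTouching (discreteDomainGraph Ω δ) (compVol Ω a δ) :=
  mem_edgesTouching_iff.2 ⟨(SimpleGraph.mem_edgeSet _).2 (compVol_adj (h j) j), f + cornerOff j, h j, Sym2.mem_mk_left _ _⟩

/-- Faces of sites of the component volume are in its plaquette set. [folklore] -/
theorem faceAt_mem_P {y : Site 2} (hy : y ∈ compVol Ω a δ) (k : Fin 4) :
    faceAt y k ∈ (↑(fillFinset (touchPlaquettes (compVol Ω a δ))) : Set (Site 2)) :=
  Finset.mem_coe.2 (subset_fillFinset _ (faceAt_mem_touchPlaquettes hy k))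

/-- A site of the component volume is in its plaquette set (as the plaquette it is the lower-left
corner of). [folklore] -/
theorem mem_P_of_mem {y : Site 2} (hy : y ∈ compVol Ω a δ) :
    y ∈ (↑(fillFinset (touchPlaquettes (compVol Ω a δ))) : Set (Site 2)) := by
  simpa [faceAt_zero_eq] using faceAt_mem_P hy 0

/-- Site data in a box of the component volume. [folklore] -/
theorem siteData_of_box {q : Site 2} {n : ℤ} (hbox : ∀ y ∈ sqBox q (n + 1), y ∈ compVol Ω a δ) {y : Site 2}
    (hy : y ∈ sqBox q n) : SiteData (compVol Ω a δ) ↑(fillFinset (touchPlaquettes (compVol Ω a δ))) y :=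
  ⟨hbox y (sqBox_mono _ (by omega) hy), hbox _ (add_cornerUnit_mem_sqBox hy 2), hbox _ (add_cornerUnit_mem_sqBox hy 3),
    faceAt_mem_P (hbox y (sqBox_mono _ (by omega) hy))⟩

end Common

/-! ### Near `b`: the sink -/

/-- **Lemma 3.10 on the lattice near the background spin `b`.** There is `r > 0` such that for all
small `δ`: for lattice radii `3 ≤ R₁`, `t`, `R₂` (`2R₁ ≤ R₂`, `R₁ + t + 6 ≤ R₂`, `(R₂ + 2)δ ≤ r`,
Beurling smallness of `(t + 4)/(R₁ - 1)`), a constant `c₀` and `m ≥ 0` with `|Hw - c₀|, |Hb - c₀| ≤ m`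
on the annulus `sqBox b̂ R₂ ∖ sqBox b̂ (R₁ + t)`, the values on the layer `sqBox b̂ R₁ ∖ sqBox b̂ (R₁-1)`
satisfy `-132 m ≤ H - c₀ ≤ m`. [cite: ChelkakHonglerIzyurovAnnals2015, Lemma 3.10] -/
theorem twoPointFamily_layer_sink (hΩo : IsOpen Ω) (hΩc : IsConnected Ω) (hM : MeshApproximates Ω) (ha : a ∈ Ω)
    (hHF : ∀ᶠ δ in 𝓝[>] (0 : ℝ), HoleFree (↑(meshInteriorFinset Ω δ) : Set (Site 2))) {b : ℂ} (hb : b ∈ Ω)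
    (hab : a ≠ b) :
    ∃ r > 0, ∀ᶠ δ in 𝓝[>] (0 : ℝ), ∀ R₁ t R₂ : ℕ, 3 ≤ R₁ → 2 * R₁ ≤ R₂ → R₁ + t + 6 ≤ R₂ → ((R₂ : ℝ) + 2) * δ ≤ r →
      beurlingConst * ((((t + 3 : ℕ) : ℝ) + 1) / (((R₁ - 2 : ℕ) : ℝ) + 1)) ^ beurlingExp ≤ 1 / 2 →
      ∀ c₀ m : ℝ, 0 ≤ m →
      (∀ y ∈ sqBox (nearestSite δ b) R₂, y ∉ sqBox (nearestSite δ b) ((R₁ : ℤ) + t) →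
        |(twoPointFamily Ω a b).Hw δ y - c₀| ≤ m ∧ |(twoPointFamily Ω a b).Hb δ y - c₀| ≤ m) →
      ∀ u₀ ∈ sqBox (nearestSite δ b) R₁, u₀ ∉ sqBox (nearestSite δ b) ((R₁ : ℤ) - 1) →
        -(132 * m) ≤ (twoPointFamily Ω a b).Hw δ u₀ - c₀ ∧ (twoPointFamily Ω a b).Hw δ u₀ - c₀ ≤ m ∧
        -(132 * m) ≤ (twoPointFamily Ω a b).Hb δ u₀ - c₀ ∧ (twoPointFamily Ω a b).Hb δ u₀ - c₀ ≤ m := by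
  -- a disc around `b` in `Ω`, away from `a`
  obtain ⟨ρ, hρ, hρΩ⟩ := Metric.isOpen_iff.1 hΩo b hb
  have hab' : 0 < dist a b := dist_pos.2 hab
  set r : ℝ := min (ρ / 4) (dist a b / 8) with hr
  have hr0 : 0 < r := by positivity
  have hrρ : r ≤ ρ / 4 := min_le_left _ _
  have hrab : r ≤ dist a b / 8 := min_le_right _ _
  have hball : closedBall b (3 * r) ⊆ Ω := fun z hz => hρΩ (mem_ball.2 (lt_of_le_of_lt (mem_closedBall.1 hz) (by linarith)))
  refine ⟨r, hr0, ?_⟩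
  have hδr : ∀ᶠ δ in 𝓝[>] (0 : ℝ), δ < r := mem_nhdsWithin_of_mem_nhds (Iio_mem_nhds hr0)
  filter_upwards [eventually_goodScale hΩo hM ha hHF, eventually_ball_subset_compVol hΩo hΩc hM ha hball, hδr,
    self_mem_nhdsWithin] with δ hgood hbulk hδr hδ0
  intro R₁ t R₂ hR₁ h2R htR hR₂ hB c₀ m hm hann u₀ hu₀ hu₀'
  have hδ0 : (0 : ℝ) < δ := hδ0
  obtain ⟨hcuts, h0, hodd, hprim, -⟩ := twoPointData_spec b hgood
  rw [← twoPointFamily_cut] at hcuts h0 hodd hprim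
  rw [← twoPointFamily_Hw, ← twoPointFamily_Hb] at hprim
  have hG : ∀ v ∈ compVol Ω a δ, ∀ k : Fin 4, (discreteDomainGraph Ω δ).Adj v (v + cornerUnit k) := fun v hv k => compVol_adj hv k
  have hle := discreteDomainGraph_le_zdGraph Ω δ
  -- the box `sqBox b̂ (R₂ + 2)` is in the component volume and away from the source plaquette
  have hbdist : dist (meshPoint δ (nearestSite δ b)) b ≤ δ := dist_meshPoint_nearestSite_le hδ0 b
  have hR₂' : 2 * δ * (((R₂ : ℤ) + 2 : ℤ) : ℝ) ≤ 2 * r := by push_cast; nlinarith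
  have hbox : ∀ y ∈ sqBox (nearestSite δ b) ((R₂ : ℤ) + 2), y ∈ compVol Ω a δ := fun y hy =>
    hbulk y ((dist_meshPoint_le_of_mem_sqBox_near hδ0 hbdist hy).trans (by linarith))
  have hbox1 : ∀ y ∈ sqBox (nearestSite δ b) ((R₂ : ℤ) + 1), y ∈ compVol Ω a δ := fun y hy => hbox y (sqBox_mono _ (by omega) hy)
  have hbox0 : ∀ y ∈ sqBox (nearestSite δ b) (R₂ : ℤ), y ∈ compVol Ω a δ := fun y hy => hbox y (sqBox_mono _ (by omega) hy)
  have hpdist : dist (meshPoint δ (sourcePlaq δ a)) a ≤ 3 * δ :=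
    (dist_triangle _ (meshPoint δ (nearestSite δ a)) _).trans (by
      linarith [dist_meshPoint_sourcePlaq_le hδ0.le a, dist_meshPoint_nearestSite_le hδ0 a])
  have hfar : ∀ y ∈ sqBox (nearestSite δ b) ((R₂ : ℤ) + 2), y ≠ sourcePlaq δ a := by
    intro y hy heq
    have h1 : dist (meshPoint δ y) b ≤ 3 * r := (dist_meshPoint_le_of_mem_sqBox_near hδ0 hbdist hy).trans (by linarith)
    rw [heq] at h1
    have h3 := dist_triangle a (meshPoint δ (sourcePlaq δ a)) b
    rw [_root_.dist_comm a (meshPoint δ (sourcePlaq δ a))] at h3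
    linarith
  have hcornR : ∀ {f : Site 2}, f ∈ sqBox (nearestSite δ b) ((R₂ : ℤ) - 1) → ∀ j : Fin 4, f + cornerOff j ∈ sqBox (nearestSite δ b) R₂ :=
    fun hf j => by have := add_cornerOff_mem_sqBox hf j; rwa [sub_add_cancel] at this
  have hunitR : ∀ {f : Site 2}, f ∈ sqBox (nearestSite δ b) ((R₂ : ℤ) - 1) → ∀ k : Fin 4, f + cornerUnit k ∈ sqBox (nearestSite δ b) R₂ :=
    fun hf k => by have := add_cornerUnit_mem_sqBox hf k; rwa [sub_add_cancel] at this
  have key := layer_bound_sink (fun x => (twoPointFamily Ω a b).Hw δ x - c₀) (fun x => (twoPointFamily Ω a b).Hb δ x - c₀)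
    (nearestSite δ b) hR₁ h2R htR hm (fun y hy hy' => (hann y hy hy').1) (fun y hy hy' => (hann y hy hy').2)
    (fun v hv hvb => by
      rw [latticeLaplacian_sub_const]
      exact hprim.latticeLaplacian_white_nonpos_of_mem _ hG hle hcuts (hbox0 v (sqBox_mono _ (by omega) hv))
        (by rwa [Finset.mem_singleton]))
    (fun f hf => by
      rw [latticeLaplacian_sub_const]
      have hfΛ : f ∈ compVol Ω a δ := hbox0 f (sqBox_mono _ (by omega) hf)
      have hcorn : ∀ j : Fin 4, f + cornerOff j ∈ compVol Ω a δ := fun j => hbox0 _ (hcornR hf j)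
      refine hprim.latticeLaplacian_black_nonneg hcuts (mem_P_of_mem hfΛ) (fun j => mem_P_of_mem (hbox0 _ (hunitR hf _)))
        (sides_mem_edgesTouching hcorn) ?_
      have hft : f ∈ touchPlaquettes (compVol Ω a δ) := by simpa [faceAt_zero_eq] using faceAt_mem_touchPlaquettes hfΛ 0
      exact hodd f hft (hfar f (sqBox_mono _ (by omega) hf)))
    (fun y hy => by
      have := hprim.hw_le_hb _ (faceAt_mem_P (hbox0 y hy) 0)
      rw [faceAt_zero_eq] at this
      show _ - c₀ ≤ _ - c₀
      linarith)
    (fun f hf m' hm' j => by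
      have hfΛ : f ∈ compVol Ω a δ := hbox0 f (sqBox_mono _ (by omega) hf)
      have hdata : ∀ j : Fin 4, SiteData (compVol Ω a δ) ↑(fillFinset (touchPlaquettes (compVol Ω a δ))) (f + cornerOff j) :=
        fun j => siteData_of_box (n := R₂) hbox1 (hcornR hf j)
      have hpar := lowSigns_face_prod (compVol_subset (Ω := Ω) (a := a) (δ := δ)) compVol_preconnected hcuts
        (sourcePlaq_mem_touchPlaquettes hgood.2) h0 (nearestSite δ b) (hbox0 _ (hunitR hf 0)) hfΛ
        (hfar f (sqBox_mono _ (by omega) hf))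
      have hm'' : ∀ j : Fin 4, (twoPointFamily Ω a b).Hb δ (f + cornerUnit (j + 3)) - (twoPointFamily Ω a b).Hb δ f ≤ m' :=
        fun j => by have := hm' j; linarith
      have := face_comparability_kc _ hprim hcuts hG hle (mem_P_of_mem hfΛ) (fun j => mem_P_of_mem (hbox0 _ (hunitR hf _)))
        hdata hpar hm'' j
      show _ - c₀ - (_ - c₀) ≤ _
      linarith)
    hB u₀ hu₀ hu₀'
  exact key

/-! ### Near `a`: the source -/

/-- **Lemma 3.10 on the lattice near the source `a`.** The same around `p₀ = sourcePlaq δ a`, with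
the roles of the colours exchanged: `-m ≤ H - c₀ ≤ 132 m` on the layer. [cite: ChelkakHonglerIzyurovAnnals2015, Lemma 3.10] -/
theorem twoPointFamily_layer_source (hΩo : IsOpen Ω) (hΩc : IsConnected Ω) (hM : MeshApproximates Ω) (ha : a ∈ Ω)
    (hHF : ∀ᶠ δ in 𝓝[>] (0 : ℝ), HoleFree (↑(meshInteriorFinset Ω δ) : Set (Site 2))) {b : ℂ} (hab : a ≠ b) :
    ∃ r > 0, ∀ᶠ δ in 𝓝[>] (0 : ℝ), ∀ R₁ t R₂ : ℕ, 3 ≤ R₁ → 2 * R₁ + 2 ≤ R₂ → R₁ + t + 8 ≤ R₂ → ((R₂ : ℝ) + 2) * δ ≤ r →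
      beurlingConst * ((((t + 5 : ℕ) : ℝ) + 1) / (((R₁ - 2 : ℕ) : ℝ) + 1)) ^ beurlingExp ≤ 1 / 2 →
      ∀ c₀ m : ℝ, 0 ≤ m →
      (∀ y ∈ sqBox (sourcePlaq δ a) R₂, y ∉ sqBox (sourcePlaq δ a) ((R₁ : ℤ) + t) →
        |(twoPointFamily Ω a b).Hw δ y - c₀| ≤ m ∧ |(twoPointFamily Ω a b).Hb δ y - c₀| ≤ m) →
      ∀ f₀ ∈ sqBox (sourcePlaq δ a) R₁, f₀ ∉ sqBox (sourcePlaq δ a) ((R₁ : ℤ) - 1) →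
        -m ≤ (twoPointFamily Ω a b).Hw δ f₀ - c₀ ∧ (twoPointFamily Ω a b).Hw δ f₀ - c₀ ≤ 132 * m ∧
        -m ≤ (twoPointFamily Ω a b).Hb δ f₀ - c₀ ∧ (twoPointFamily Ω a b).Hb δ f₀ - c₀ ≤ 132 * m := by
  obtain ⟨ρ, hρ, hρΩ⟩ := Metric.isOpen_iff.1 hΩo a ha
  have hab' : 0 < dist a b := dist_pos.2 hab
  set r : ℝ := min (ρ / 4) (dist a b / 8) with hr
  have hr0 : 0 < r := by positivity
  have hrρ : r ≤ ρ / 4 := min_le_left _ _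
  have hrab : r ≤ dist a b / 8 := min_le_right _ _
  have hball : closedBall a (3 * r) ⊆ Ω := fun z hz => hρΩ (mem_ball.2 (lt_of_le_of_lt (mem_closedBall.1 hz) (by linarith)))
  refine ⟨r, hr0, ?_⟩
  have hδr : ∀ᶠ δ in 𝓝[>] (0 : ℝ), δ < r / 4 := mem_nhdsWithin_of_mem_nhds (Iio_mem_nhds (by positivity))
  filter_upwards [eventually_goodScale hΩo hM ha hHF, eventually_ball_subset_compVol hΩo hΩc hM ha hball, hδr,
    self_mem_nhdsWithin] with δ hgood hbulk hδr hδ0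
  intro R₁ t R₂ hR₁ h2R htR hR₂ hB c₀ m hm hann f₀ hf₀ hf₀'
  have hδ0 : (0 : ℝ) < δ := hδ0
  obtain ⟨hcuts, h0, hodd, hprim, -⟩ := twoPointData_spec b hgood
  rw [← twoPointFamily_cut] at hcuts h0 hodd hprim
  rw [← twoPointFamily_Hw, ← twoPointFamily_Hb] at hprim
  have hG : ∀ v ∈ compVol Ω a δ, ∀ k : Fin 4, (discreteDomainGraph Ω δ).Adj v (v + cornerUnit k) := fun v hv k => compVol_adj hv k
  have hle := discreteDomainGraph_le_zdGraph Ω δ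
  have hpdist : dist (meshPoint δ (sourcePlaq δ a)) a ≤ 3 * δ :=
    (dist_triangle _ (meshPoint δ (nearestSite δ a)) _).trans (by
      linarith [dist_meshPoint_sourcePlaq_le hδ0.le a, dist_meshPoint_nearestSite_le hδ0 a])
  have hR₂' : 2 * δ * (((R₂ : ℤ) + 2 : ℤ) : ℝ) ≤ 2 * r := by push_cast; nlinarith
  have hbox : ∀ y ∈ sqBox (sourcePlaq δ a) ((R₂ : ℤ) + 2), y ∈ compVol Ω a δ := fun y hy =>
    hbulk y ((dist_meshPoint_le_of_mem_sqBox_near hδ0 hpdist hy).trans (by linarith))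
  have hbox1 : ∀ y ∈ sqBox (sourcePlaq δ a) ((R₂ : ℤ) + 1), y ∈ compVol Ω a δ := fun y hy => hbox y (sqBox_mono _ (by omega) hy)
  have hbox0 : ∀ y ∈ sqBox (sourcePlaq δ a) (R₂ : ℤ), y ∈ compVol Ω a δ := fun y hy => hbox y (sqBox_mono _ (by omega) hy)
  -- the box is away from `b̂`
  have hfar : ∀ y ∈ sqBox (sourcePlaq δ a) ((R₂ : ℤ) + 2), y ≠ nearestSite δ b := by
    intro y hy heq
    have h1 : dist (meshPoint δ y) a ≤ 3 * r := (dist_meshPoint_le_of_mem_sqBox_near hδ0 hpdist hy).trans (by linarith)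
    rw [heq] at h1
    have h2 : dist (meshPoint δ (nearestSite δ b)) b ≤ δ := dist_meshPoint_nearestSite_le hδ0 b
    have h3 := dist_triangle a (meshPoint δ (nearestSite δ b)) b
    rw [_root_.dist_comm a (meshPoint δ (nearestSite δ b))] at h3
    linarith
  have hunitR : ∀ {u : Site 2}, u ∈ sqBox (sourcePlaq δ a) ((R₂ : ℤ) - 1) → ∀ k : Fin 4, u + cornerUnit k ∈ sqBox (sourcePlaq δ a) R₂ :=
    fun hu k => by have := add_cornerUnit_mem_sqBox hu k; rwa [sub_add_cancel] at this
  have hcornR : ∀ {f : Site 2}, f ∈ sqBox (sourcePlaq δ a) ((R₂ : ℤ) - 1) → ∀ j : Fin 4, f + cornerOff j ∈ sqBox (sourcePlaq δ a) R₂ :=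
    fun hf j => by have := add_cornerOff_mem_sqBox hf j; rwa [sub_add_cancel] at this
  have key := layer_bound_source (fun x => (twoPointFamily Ω a b).Hw δ x - c₀) (fun x => (twoPointFamily Ω a b).Hb δ x - c₀)
    (sourcePlaq δ a) hR₁ h2R htR hm (fun y hy hy' => (hann y hy hy').1) (fun y hy hy' => (hann y hy hy').2)
    (fun v hv => by
      rw [latticeLaplacian_sub_const]
      exact hprim.latticeLaplacian_white_nonpos_of_mem _ hG hle hcuts (hbox0 v (sqBox_mono _ (by omega) hv))
        (by rw [Finset.mem_singleton]; exact hfar v (sqBox_mono _ (by omega) hv)))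
    (fun f hf hfp => by
      rw [latticeLaplacian_sub_const]
      have hfΛ : f ∈ compVol Ω a δ := hbox0 f (sqBox_mono _ (by omega) hf)
      have hcorn : ∀ j : Fin 4, f + cornerOff j ∈ compVol Ω a δ := fun j => hbox0 _ (hcornR hf j)
      refine hprim.latticeLaplacian_black_nonneg hcuts (mem_P_of_mem hfΛ) (fun j => mem_P_of_mem (hbox0 _ (hunitR hf _)))
        (sides_mem_edgesTouching hcorn) ?_
      have hft : f ∈ touchPlaquettes (compVol Ω a δ) := by simpa [faceAt_zero_eq] using faceAt_mem_touchPlaquettes hfΛ 0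
      exact hodd f hft hfp)
    (fun y hy => by
      have := hprim.hw_le_hb _ (faceAt_mem_P (hbox0 y hy) 0)
      rw [faceAt_zero_eq] at this
      show _ - c₀ ≤ _ - c₀
      linarith)
    (fun u hu _ m' hm' k => by
      have hu1 : u ∈ sqBox (sourcePlaq δ a) (R₂ : ℤ) := sqBox_mono _ (by omega) hu
      have hdu : SiteData (compVol Ω a δ) ↑(fillFinset (touchPlaquettes (compVol Ω a δ))) u := siteData_of_box (n := R₂) hbox1 hu1
      have hdn : ∀ k : Fin 4, SiteData (compVol Ω a δ) ↑(fillFinset (touchPlaquettes (compVol Ω a δ))) (u + cornerUnit k) :=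
        fun k => siteData_of_box (n := R₂) hbox1 (hunitR hu k)
      have hpar : siteSign {nearestSite δ b} ((twoPointFamily Ω a b).cut δ) u 0 * siteSign {nearestSite δ b} ((twoPointFamily Ω a b).cut δ) u 1 *
          siteSign {nearestSite δ b} ((twoPointFamily Ω a b).cut δ) u 2 * siteSign {nearestSite δ b} ((twoPointFamily Ω a b).cut δ) u 3 = 1 := by
        rw [siteSign_prod, hLowSign_singleton_west_mul, if_neg (hfar u (sqBox_mono _ (by omega) hu))]
      have hm'' : ∀ k : Fin 4, (twoPointFamily Ω a b).Hw δ u - (twoPointFamily Ω a b).Hw δ (u + cornerUnit k) ≤ m' :=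
        fun k => by have := hm' k; linarith
      have := site_comparability_kc _ hprim hcuts hG hle hdu hdn hpar hm'' k
      show _ - c₀ - (_ - c₀) ≤ _
      linarith)
    hB f₀ hf₀ hf₀'
  exact key

end Literature.Probability.LatticeModels
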